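import Summits.QuantumFields.BalabanUV.T4Continuum.Spine.NE1p.DressedRoot
import Summits.QuantumFields.BalabanUV.T4Continuum.Support.T4TrajectoryDensityAssembly
import Summits.QuantumFields.BalabanUV.T4Continuum.Support.T4TrajectoryDensityFreshBooking

/-!
# T⁴ programme, spine estimate NE1′ (node O3b/H2) — END-F′: THE TRANSPORT LEAF `htr` WITH THE CENTRED PERTURBATION SLICE `hP`
# ASSEMBLED UNDER THE HISTORY AND THE BUDGET BINDER GONE (swarm row S2 «END-F′ plumbing» of `t4/formal/NE1p/LEAVES.md`)

Cell `pub-balaban`, sub-cell `t4`, BINDER-OWNERS row NE1′, NE1′ FORMALISATION SWARM `b2b-balaban-t4-ne1p-formalise-*`, leaf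
prover 01 (unit `b2b-balaban-t4-ne1p-formalise-leaf-01`); owner lineage t4-ne1p-p1 (skeleton `t4/skeletons/NE1p-t4-ne1p-p1.md`
v1.1 §6 seat S2); tree target `Summits/QuantumFields/BalabanUV/T4Continuum/Spine/NE1p/`; ADDITIVE — imports the row root
`Spine/NE1p/DressedRoot` (END-F `transportLeaf_of_centredExponent`), `Support/T4TrajectoryDensityAssembly`
(`pertSlice_under_history`) and `Support/T4TrajectoryDensityFreshBooking` (`stepProd_psi_mul`) ONLY; modifies nothing.

WHAT THIS FILE DOES (kernel plumbing named in the headers of `T4TrajectoryDensityGated` §20 and `T4TrajectoryDensityAssembly`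
§22 as «the instantiating seat's plumbing»).  END-F concludes the field `BookingLeaves.htr` — `T.TransportsFromVar (4c_δ/r) (ψ·α)
(budgetGate T s m S (4c_δ/r) (ψ·α))` — from the wall binders F-1…F-9, among them
`hP` : the CENTRED observable-attached exponent of the met component of `(b, k)` is a perturbation slice of size
`m·Σ_{f ∈ S k b} envVar (4c_δ/r) (ψ·α) f k` under the history.  `T4TrajectoryDensityAssembly.pertSlice_under_history` produces
such a slice with the FUNCTION-LEVEL size `s1 b k = ‖c b k‖·Σ_{p ∈ Sg k b} 4·Asz p.1 p.2 k / rs p.1 p.2 k · δf b k p` (live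
generations `p = (f, k″)` of the component, their current slice sizes `Asz` and radii `rs`, transverse fresh defects `δf`), but
asks the budget `s b k + s1 b k ≤ 1` whenever the gate of scale `k` holds.  The two are joined here by ONE booked inequality and
ONE strengthened history:
* §1 `budgetShare_le` [arith]: slice sizes `Asz ≤ gen·stepProd α` (the §15 size law under the budget), a chart-radius floor
  `r_* ≤ rs`, transverse defects `0 ≤ δf ≤ c_δψ^{k−k″}`, live generations drawn from the live families, and the source factor
  against the budget factor `‖c b k‖·r ≤ m·r_*` ⟹ `s1 b k ≤ m·Σ_{f ∈ S k b} envVar (4c_δ/r) (ψ·α) f k` — the computation of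
  `T4TrajectoryDensityFreshBooking.envelopeResponse_of_booking` stopped at the raw envelope (`budgetGate` asks exactly this sum;
  no class bound is needed), with `sum_gen_le_sum_fam` regrouping generations under families (`Finset.sum_finset_product`).
* §2 `transportLeaf_assembled` — **END-F′**: `DressedRoot.transportLeaf_of_centredExponent` with `hP` REPLACED by the Assembly's
  data (`hQ` the centred exponent IS the fresh sum over the live generations, `hSg` live generations ⊆ live families × born scales,
  `hs1`/`hAsz_birth`/`hAsz_step`/`hrs_birth`/`hrs_step` the size/radius recursions AS EQUALITIES the instantiation defines,
  `hrs_dec`/`hmargin`/`hN1x`/`hN2cx`/`hpairx`/`hδfw`/`hmeas` the cross-family window geometry (w3)⁺ and fresh pairs (I4′)) plus the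
  scalar side conditions of §1 (`hϱfloor`, `hrstar`, `hδf`, `hcm`, `hcδ`, `hψ`), and NO `hP`, NO `hs`, NO `hbudget`.  Inside: the
  strengthened gate `G′ i := budgetGate … i ∧ (∀ b alive at i, s b i + s1 b i ≤ 1)`; (a) under `RanBelow G′ k` every live
  generation has `0 ≤ Asz f k″ k ≤ gen f k″·stepProd α k″ k` (induction on `k`; the step factor `e^{3(s+s1)} ≤ e³ ≤
  e³(1+4θ/ϱ) ≤ α` by `hdom`); (b) hence `s1 b k ≤ m·Σ envVar` (§1); (c) hence `RanBelow (budgetGate …) k → RanBelow G′ k`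
  (induction: the dressed budget of scale `k` and (b) give the function-level budget); (d) `pertSlice_under_history` with
  `Gate := G′` (its `hbudget` is the second conjunct) and `PertSlice.mono` from `s1 b k` to `m·Σ envVar` give `hP` VERBATIM;
  (e) END-F BY NAME.  Conclusion: LITERALLY the field type of `BookingLeaves.htr` (trigger c4: a leaf counts when the conclusion is
  verbatim a field of `BookingLeaves` or a binder of END-F — here it is END-F's own conclusion with one binder fewer).

HONEST FRAMING.  Rung (B)+1 bookkeeping on ONE finite four-torus of fixed physical size — NOT infinite volume, NOT a mass gap, NOT
OS on ℝ⁴, NOT the Clay problem, NOT summit progress.  NE1′ is NOT PRINTED and NOT PROVED; this file reads «L-T ⇐ F-1, F-2, F-3,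
F-5…F-9 + the Assembly's dictionary/geometry binders», never «NE1′ proved»: the wall of record `t4/T4-EST-NE1p-P1.md` §4 — (w1)
`hsl` births, H2 `hFn`/`hQ` step law and fresh-sum dictionary, (w2-act) `hB`/`hE` (printed TYPE [Balaban1989LargeFieldII] (1.65)
p. 375, (1.71)–(1.75) pp. 379–380; asserted for Bałaban's densities NOWHERE), (w3)⁺ window nesting, (w4) `hdom`, (I4′) `hrate`/
`hδf` transverse defects at rate `ψ` (the cell's READING, CITED-FACTS-T4 v1 §2/§4: no printed commutation identity), attainment,
invariance — stays DISPLAYED; 0 binders are instantiated on Bałaban's densities; no `def … : Prop` is minted.  [folklore] kernel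
glue, 0 sorry, 0 citations used as hypothesis-free facts.  Spine PROVED 0∕9 unchanged.  HONEST DEPENDENCY: continuum YM on T⁴ ⇐
BetaPertH ∧ nine spine estimates (0/9 proved); BetaPertH ⇐ (D1) ∧ (D4) ∧ CAP+tail; G-an2-4 gates asym, D1 and NE2/3/4.
-/

noncomputable section

namespace Summit.QuantumFields.BalabanUV.T4Continuum.NE1p.DressedTransportAssembled

open MeasureTheory Set Metric Filter Finset
open scoped BigOperators
open Literature.MathematicalPhysics.QuantumFieldTheory.Balaban1983to89
open Literature.MathematicalPhysics.QuantumFieldTheory.Balaban1983to89.T4TermFormat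
open Literature.MathematicalPhysics.QuantumFieldTheory.Balaban1983to89.T4TermFormat.Booking
open Literature.MathematicalPhysics.QuantumFieldTheory.Balaban1983to89.T4GatedBooking
open Literature.MathematicalPhysics.QuantumFieldTheory.Balaban1983to89.T4TrajectoryComparison
open Literature.MathematicalPhysics.QuantumFieldTheory.Balaban1983to89.T4TrajectoryModulus
open Summit.QuantumFields.BalabanUV.T4Continuum.T4TrajectoryDensityDressed
open Summit.QuantumFields.BalabanUV.T4Continuum.NE1p.DressedRoot
open T4BirthChartTransport (GaugeInvariant BirthSlice RelGauge)
open T4BlockTransport (Fld NDir latMove latN latMove_zero)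
open T4TrajectoryDensity

/-! ## §1 The booked link: the function-level fresh budget is below the dressed budget's envelope share [arith] -/

section BookedLink

variable {B : T4TermFormat.Booking} {T : Trajectory B}

/-- Regrouping generations under families: a finset `Sg` of generations `(f, k″)` drawn from the live families `S` with born
scales `j f ≤ k″ ≤ k` sums a nonnegative quantity to at most the family-by-family sum over ALL generations `k″ ∈ [j f, k]`
(`Finset.sum_finset_product` on the finset of all such pairs, then `sum_le_sum_of_subset_of_nonneg`). [arith] [folklore] -/
theorem sum_gen_le_sum_fam {ι : Type*} [DecidableEq ι] {Sg : Finset (ι × ℕ)} {S : Finset ι} {j : ι → ℕ} {k : ℕ}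
    {X : ι × ℕ → ℝ} (hSg : ∀ p ∈ Sg, p.1 ∈ S ∧ j p.1 ≤ p.2 ∧ p.2 ≤ k)
    (hX : ∀ f ∈ S, ∀ k'', j f ≤ k'' → k'' ≤ k → 0 ≤ X (f, k'')) :
    ∑ p ∈ Sg, X p ≤ ∑ f ∈ S, ∑ k'' ∈ Finset.Icc (j f) k, X (f, k'') := by
  set r : Finset (ι × ℕ) := (S ×ˢ range (k + 1)).filter fun p => j p.1 ≤ p.2 with hr
  have hmem : ∀ p : ι × ℕ, p ∈ r ↔ p.1 ∈ S ∧ p.2 ∈ Finset.Icc (j p.1) k := by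
    intro p
    rw [hr, Finset.mem_filter, Finset.mem_product, Finset.mem_range, Finset.mem_Icc, Nat.lt_succ_iff]
    tauto
  rw [← sum_finset_product r S (fun f => Finset.Icc (j f) k) hmem]
  refine sum_le_sum_of_subset_of_nonneg (fun p hp => ?_) fun p hp _ => ?_
  · obtain ⟨h1, h2, h3⟩ := hSg p hp
    exact (hmem p).mpr ⟨h1, Finset.mem_Icc.mpr ⟨h2, h3⟩⟩
  · obtain ⟨h1, h2⟩ := (hmem p).mp hp
    exact hX p.1 h1 p.2 (Finset.mem_Icc.mp h2).1 (Finset.mem_Icc.mp h2).2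

/-- The envelope is linear in its constant: `envVar C ρ b k = C·envVar 1 ρ b k`. [arith] [folklore] -/
theorem envVar_eq_const_mul (C : ℝ) (ρ : ℕ → ℝ) (b : B.Birth) (k : ℕ) :
    T.envVar C ρ b k = C * T.envVar 1 ρ b k := by
  unfold Trajectory.envVar
  rw [mul_sum]
  exact sum_congr rfl fun k' _ => by ring

/-- **THE BOOKED LINK** [arith].  At one met component `(b, k)`: live generations `p = (f, k″) ∈ Sg` drawn from the live
families `S` with `birthScale f ≤ k″ ≤ k`; slice sizes `0 ≤ A p ≤ gen f k″·stepProd α k″ k` (the §15 size law under the budget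
history with the domination `e³ ≤ α`); radii `rs p ≥ r_* > 0`; transverse fresh defects `0 ≤ δ p ≤ c_δ·ψ^{k−k″}` (`c_δ, ψ ≥ 0`,
`α ≥ 0`); the source factor against the budget factor `‖c‖·r ≤ m·r_*` (`r > 0`) ⟹
`‖c‖·Σ_{p∈Sg} 4·A p / rs p·δ p ≤ m·Σ_{f∈S} envVar (4c_δ/r) (ψ·α) f k` — generation by generation
`4A/rs·δ ≤ (4c_δ/r_*)·stepProd (ψα) k″ k·gen f k″` (`stepProd_psi_mul`), regrouped under families (`sum_gen_le_sum_fam`), and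
`Σ_{k″∈[j,k]} stepProd (ψα) k″ k·gen f k″ = envVar 1 (ψα) f k` by definition.  The same computation as
`T4TrajectoryDensityFreshBooking.envelopeResponse_of_booking`, stopped before the class bound: `budgetGate` asks the raw sum.
[folklore] -/
theorem budgetShare_le {Sg : Finset (B.Birth × ℕ)} {S : Finset B.Birth} {k : ℕ} {A rs δ : B.Birth × ℕ → ℝ}
    {α : ℕ → ℝ} {cnorm cδ ψ r rstar m : ℝ}
    (hα : ∀ i, 0 ≤ α i) (hψ : 0 ≤ ψ) (hcδ : 0 ≤ cδ) (hr : 0 < r) (hrstar : 0 < rstar) (hcnorm : 0 ≤ cnorm)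
    (hcm : cnorm * r ≤ m * rstar)
    (hSg : ∀ p ∈ Sg, p.1 ∈ S ∧ B.birthScale p.1 ≤ p.2 ∧ p.2 ≤ k)
    (hA : ∀ p ∈ Sg, 0 ≤ A p ∧ A p ≤ T.gen p.1 p.2 * stepProd α p.2 k)
    (hrs : ∀ p ∈ Sg, rstar ≤ rs p)
    (hδ : ∀ p ∈ Sg, 0 ≤ δ p ∧ δ p ≤ cδ * ψ ^ (k - p.2)) :
    cnorm * ∑ p ∈ Sg, 4 * A p / rs p * δ p ≤ m * ∑ f ∈ S, T.envVar (4 * cδ / r) (fun i => ψ * α i) f k := by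
  classical
  -- the per-generation quantity of the envelope and its nonnegativity
  set Y : B.Birth × ℕ → ℝ := fun p => stepProd (fun i => ψ * α i) p.2 k * T.gen p.1 p.2 with hY
  have hY0 : ∀ p : B.Birth × ℕ, 0 ≤ Y p := fun p => by
    rw [hY]
    exact mul_nonneg (stepProd_nonneg (fun i => mul_nonneg hψ (hα i)) _ _) (T.gen_nonneg _ _)
  -- generation by generation
  have hterm : ∀ p ∈ Sg, 4 * A p / rs p * δ p ≤ 4 * cδ / rstar * Y p := by
    intro p hp
    obtain ⟨hA0, hAle⟩ := hA p hp
    obtain ⟨hδ0, hδle⟩ := hδ p hp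
    have hrsp : 0 < rs p := lt_of_lt_of_le hrstar (hrs p hp)
    have hsp : 0 ≤ stepProd α p.2 k := stepProd_nonneg hα _ _
    have hM : 0 ≤ 4 * (T.gen p.1 p.2 * stepProd α p.2 k) / rstar := by
      have := T.gen_nonneg p.1 p.2
      positivity
    calc 4 * A p / rs p * δ p ≤ 4 * (T.gen p.1 p.2 * stepProd α p.2 k) / rstar * δ p := by
          refine mul_le_mul_of_nonneg_right ?_ hδ0
          calc 4 * A p / rs p ≤ 4 * (T.gen p.1 p.2 * stepProd α p.2 k) / rs p :=
                div_le_div_of_nonneg_right (by linarith) hrsp.le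
            _ ≤ 4 * (T.gen p.1 p.2 * stepProd α p.2 k) / rstar :=
                div_le_div_of_nonneg_left (by have := T.gen_nonneg p.1 p.2; positivity) hrstar (hrs p hp)
      _ ≤ 4 * (T.gen p.1 p.2 * stepProd α p.2 k) / rstar * (cδ * ψ ^ (k - p.2)) :=
          mul_le_mul_of_nonneg_left hδle hM
      _ = 4 * cδ / rstar * Y p := by
          rw [hY]
          simp only
          rw [stepProd_psi_mul]
          ring
  -- regroup under families: the raw envelope with constant 1
  have hregroup : ∑ p ∈ Sg, Y p ≤ ∑ f ∈ S, T.envVar 1 (fun i => ψ * α i) f k := by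
    have h := sum_gen_le_sum_fam (X := Y) hSg (fun f _ k'' _ _ => hY0 (f, k''))
    refine h.trans (le_of_eq (sum_congr rfl fun f _ => ?_))
    unfold Trajectory.envVar
    exact sum_congr rfl fun k'' _ => by rw [hY, one_mul]
  have hE0 : 0 ≤ ∑ f ∈ S, T.envVar 1 (fun i => ψ * α i) f k :=
    sum_nonneg fun f _ => Trajectory.envVar_nonneg zero_le_one (fun i => mul_nonneg hψ (hα i)) f k
  -- the constants: `‖c‖/r_* ≤ m/r`
  have hratio : cnorm / rstar ≤ m / r := by
    rw [div_le_div_iff₀ hrstar hr]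
    linarith
  have hconst : cnorm * (4 * cδ / rstar) ≤ m * (4 * cδ / r) := by
    have e1 : cnorm * (4 * cδ / rstar) = 4 * cδ * (cnorm / rstar) := by ring
    have e2 : m * (4 * cδ / r) = 4 * cδ * (m / r) := by ring
    rw [e1, e2]
    exact mul_le_mul_of_nonneg_left hratio (by positivity)
  calc cnorm * ∑ p ∈ Sg, 4 * A p / rs p * δ p ≤ cnorm * ∑ p ∈ Sg, 4 * cδ / rstar * Y p :=
        mul_le_mul_of_nonneg_left (sum_le_sum hterm) hcnorm
    _ = cnorm * (4 * cδ / rstar) * ∑ p ∈ Sg, Y p := by rw [← mul_sum, mul_assoc]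
    _ ≤ cnorm * (4 * cδ / rstar) * ∑ f ∈ S, T.envVar 1 (fun i => ψ * α i) f k :=
        mul_le_mul_of_nonneg_left hregroup (by positivity)
    _ ≤ m * (4 * cδ / r) * ∑ f ∈ S, T.envVar 1 (fun i => ψ * α i) f k := mul_le_mul_of_nonneg_right hconst hE0
    _ = m * ∑ f ∈ S, T.envVar (4 * cδ / r) (fun i => ψ * α i) f k := by
        rw [mul_assoc, mul_sum]
        exact congrArg (m * ·) (sum_congr rfl fun f _ => (envVar_eq_const_mul _ _ f k).symm)

end BookedLink

/-! ## §2 END-F′: the transport leaf with `hP` assembled under the history and no budget binder [bookkeeping] -/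

section FunctionLevel

variable {B : T4TermFormat.Booking} {T : Trajectory B}
variable {R : Type*} [NormedRing R] [NormedAlgebra ℂ R] [MeasurableSpace R] {d : ℕ}

/-- **END-F′ — THE TRANSPORT LEAF `htr` OF `BookingLeaves`, ITS CENTRED PERTURBATION SLICE ASSEMBLED UNDER THE HISTORY, NO
BUDGET BINDER** [bookkeeping].  `DressedRoot.transportLeaf_of_centredExponent` (END-F) with `hP` REPLACED by the data of
`T4TrajectoryDensityAssembly.pertSlice_under_history`: per met component `(b, k)` the finset `Sg k b` of its live GENERATIONS
`p = (f, k″)` drawn from the live families `S k b` with `birthScale f ≤ k″ ≤ k` (`hSg`), the source factor `c b k`, a reference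
fluctuation `z₁ b k`, a margin radius `ϱ₁ b k`; the centred observable-attached exponent IS `c b k·Σ_{p∈Sg k b} (Fn p (U+z) −
Fn p (U+z₁))` (`hQ`, the H2 dictionary); the current slice radius `rs` and size `Asz` of every generation and the step budget `s1`
AS EQUALITIES the instantiation defines (`hrs_birth`/`hrs_step`/`hAsz_birth`/`hAsz_step`/`hs1`); radii ordered and floored
(`hrs_dec`, `hmargin`, `hϱfloor : r_* ≤ ϱ`, `hrstar : 0 < r_* ≤ r`); cross-family nesting, complex margins, fresh pairs in relative
gauge with TRANSVERSE defects `0 ≤ δf ≤ c_δψ^{k−k″}`, `δf ≤ w` ((w3)⁺, (I4′): `hN1x`/`hN2cx`/`hpairx`/`hδf`/`hδfw`); measurability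
(`hmeas`); and the K-free scalar side condition `‖c b k‖·r ≤ m·r_*` tying the source factor to the budget factor `m` of the
dressed gate (`hcm`; with `c_δ, ψ ≥ 0`).  The remaining binders are END-F's, VERBATIM: (w1) `hsl`, H2 `hFn`/`h𝒢`, (w2-act)
`hB`/`hE`, `hDμ`, (w3)⁺ `hN1`/`hN2`/`hdiam`/`hθ`, (w4) `hdom`, invariance `hinv`, (I4′) `hdefw`/`hrate`, attainment `hlin`.
NO `hP`, NO `hs`, NO `hbudget`: the budget of step `k` is the dressed gate of scale `k` itself plus §1's booked link, by a
strong induction on the scale (strengthened history `budgetGate … ∧ function-level budget`).  Conclusion: EXACTLY the field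
`htr` of `BookingLeaves` with `C = 4c_δ/r`, `ρ i = ψ·α i` — END-F's own conclusion.  Carried values in `ℂ` (the exponent's
currency).  Nothing of Bałaban's densities is asserted. [folklore] -/
theorem transportLeaf_assembled {Fn : B.Birth → ℕ → ℕ → Fld d R → ℂ}
    {rel : B.Birth → ℕ → ℕ → Fld d R → Fld d R → Prop} {𝒦 : B.Birth → ℕ → ℕ → Set (Fld d R)}
    {ref : B.Birth → ℕ → Fld d R → Fld d R} {base : B.Birth → ℕ → Fld d R → ℝ}
    {𝒜 𝒬 : B.Birth → ℕ → Fld d R → Fld d R → ℂ} {q : B.Birth → ℕ → Fld d R → ℂ}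
    {μ : B.Birth → ℕ → Measure (Fld d R)} {z₀ z₁ : B.Birth → ℕ → Fld d R} {D : B.Birth → ℕ → Set (Fld d R)}
    {defect : B.Birth → ℕ → ℕ → ℝ} {cδ ψ w r rstar m : ℝ} {s θ s1 ϱ₁ : B.Birth → ℕ → ℝ} {α : ℕ → ℝ}
    {ϱ rs Asz : B.Birth → ℕ → ℕ → ℝ} {S : ℕ → B.Birth → Finset B.Birth}
    {Sg : ℕ → B.Birth → Finset (B.Birth × ℕ)} {c : B.Birth → ℕ → ℂ} {δf : B.Birth → ℕ → B.Birth × ℕ → ℝ}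
    (hα : ∀ i, 0 ≤ α i) (hr : 0 < r) (hw : 0 < w) (hcδ : 0 ≤ cδ) (hψ : 0 ≤ ψ)
    (hrstar : 0 < rstar) (hrstar_r : rstar ≤ r)
    (hsl : ∀ (b : B.Birth) (k' : ℕ), B.birthScale b ≤ k' → k' ≤ B.K →
      RanBelow (budgetGate T s m S (4 * cδ / r) (fun i => ψ * α i)) k' →
      BirthSlice (Fn b k' k') latMove latN (𝒦 b k' k') w r (T.gen b k'))
    (hFn : ∀ (b : B.Birth) (k' k : ℕ), B.birthScale b ≤ k' → k' ≤ k → k + 1 ≤ B.K →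
      RanBelow (budgetGate T s m S (4 * cδ / r) (fun i => ψ * α i)) (k + 1) →
      ∀ U, Fn b k' (k + 1) U =
        wOp (expWeight (base b k) (𝒜 b k + 𝒬 b k)) (μ b k) (z₀ b k) U (fun z => Fn b k' k (U + z)))
    (h𝒢 : ∀ (b : B.Birth) (k' k : ℕ), B.birthScale b ≤ k' → k' ≤ k → k + 1 ≤ B.K →
      RanBelow (budgetGate T s m S (4 * cδ / r) (fun i => ψ * α i)) (k + 1) →
      ∀ U, (fun z => Fn b k' k (U + z)) ∈ BddClass ℂ (μ b k))
    (hD : ∀ b k, (D b k).Nonempty) (hϱ : ∀ b k' k, 0 < ϱ b k' k)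
    (hB : ∀ (b : B.Birth) (k' k : ℕ), B.birthScale b ≤ k' → k' ≤ k → k + 1 ≤ B.K →
      RanBelow (budgetGate T s m S (4 * cδ / r) (fun i => ψ * α i)) (k + 1) →
      RealBaseAt (ref b k) (base b k) (𝒜 b k) (μ b k) (𝒦 b k' (k + 1)))
    (hE : ∀ (b : B.Birth) (k' k : ℕ), B.birthScale b ≤ k' → k' ≤ k → k + 1 ≤ B.K →
      RanBelow (budgetGate T s m S (4 * cδ / r) (fun i => ψ * α i)) (k + 1) →
      ExponentSliceAt (ref b k) (𝒜 b k) (μ b k) latMove latN (𝒦 b k' (k + 1)) w (ϱ b k' k) (s b k))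
    -- the Assembly's dictionary: the centred observable-attached exponent IS the fresh sum over the live generations
    (hQ : ∀ b k, (fun U z => 𝒬 b k U z - q b k U) =
      fun U z => c b k * ∑ p ∈ Sg k b, (Fn p.1 p.2 k (U + z) - Fn p.1 p.2 k (U + z₁ b k)))
    (hSg : ∀ k b, ∀ p ∈ Sg k b, p.1 ∈ S k b ∧ B.birthScale p.1 ≤ p.2 ∧ p.2 ≤ k)
    (hs1 : ∀ b k, s1 b k = ‖c b k‖ * ∑ p ∈ Sg k b, 4 * Asz p.1 p.2 k / rs p.1 p.2 k * δf b k p)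
    (hAsz_birth : ∀ f k'', Asz f k'' k'' = T.gen f k'') (hrs_birth : ∀ f k'', rs f k'' k'' = r)
    (hAsz_step : ∀ f k'' k, B.birthScale f ≤ k'' → k'' ≤ k →
      Asz f k'' (k + 1) = Real.exp (3 * (s f k + s1 f k)) * Asz f k'' k)
    (hrs_step : ∀ f k'' k, B.birthScale f ≤ k'' → k'' ≤ k → rs f k'' (k + 1) = ϱ f k'' k)
    (hrs_dec : ∀ f k'' k, B.birthScale f ≤ k'' → k'' ≤ k → ϱ f k'' k < rs f k'' k)
    (hϱfloor : ∀ f k'' k, B.birthScale f ≤ k'' → k'' ≤ k → rstar ≤ ϱ f k'' k)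
    (hmargin : ∀ (b : B.Birth) (k' k : ℕ), B.birthScale b ≤ k' → k' ≤ k →
      ϱ b k' k < ϱ₁ b k ∧ 0 < ϱ₁ b k ∧ ∀ p ∈ Sg k b, ϱ₁ b k ≤ rs p.1 p.2 k)
    (hcm : ∀ b k, ‖c b k‖ * r ≤ m * rstar)
    (hδf : ∀ b k, ∀ p ∈ Sg k b, 0 ≤ δf b k p ∧ δf b k p ≤ cδ * ψ ^ (k - p.2))
    (hδfw : ∀ b k, ∀ p ∈ Sg k b, δf b k p ≤ w)
    (hDμ : ∀ b k, ∀ᵐ z ∂μ b k, z ∈ D b k)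
    (hN1 : ∀ (b : B.Birth) (k' k : ℕ), B.birthScale b ≤ k' → k' ≤ k → k + 1 ≤ B.K →
      ∀ z ∈ D b k, ∀ U ∈ 𝒦 b k' (k + 1), U + z ∈ 𝒦 b k' k)
    (hN2 : ∀ (b : B.Birth) (k' k : ℕ), B.birthScale b ≤ k' → k' ≤ k → k + 1 ≤ B.K →
      ∀ U₀ ∈ 𝒦 b k' (k + 1), ∀ p : NDir d R, latN p ≤ w → ∀ z' ∈ D b k, latMove U₀ p 1 + z' ∈ 𝒦 b k' k)
    (hN1x : ∀ (b : B.Birth) (k' k : ℕ), B.birthScale b ≤ k' → k' ≤ k →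
      ∀ p ∈ Sg k b, ∀ z ∈ D b k, ∀ U ∈ 𝒦 b k' (k + 1), U + z ∈ 𝒦 p.1 p.2 k)
    (hN2cx : ∀ (b : B.Birth) (k' k : ℕ), B.birthScale b ≤ k' → k' ≤ k →
      ∀ p ∈ Sg k b, ∀ U₀ ∈ 𝒦 b k' (k + 1), ∀ pd : NDir d R, 0 < latN pd → latN pd ≤ w →
        ∀ t ∈ tube (ϱ₁ b k / latN pd), latMove U₀ pd t + z₁ b k ∈ 𝒦 p.1 p.2 k)
    (hpairx : ∀ (b : B.Birth) (k' k : ℕ), B.birthScale b ≤ k' → k' ≤ k →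
      ∀ p ∈ Sg k b, ∀ U₀ ∈ 𝒦 b k' (k + 1), ∀ pd : NDir d R, 0 < latN pd → latN pd ≤ w →
        ∀ᵐ z ∂μ b k, ∀ t ∈ tube (ϱ₁ b k / latN pd),
          RelGauge (rel p.1 p.2 k) latMove latN (latMove U₀ pd t + z₁ b k) (latMove U₀ pd t + z) (δf b k p))
    (hdiam : ∀ b k, ∀ z ∈ D b k, ∀ z' ∈ D b k, ∀ x ν, ‖z x ν - z' x ν‖ ≤ θ b k)
    (hθ : ∀ b k, 0 < θ b k ∧ θ b k ≤ w)
    (hdom : ∀ (b : B.Birth) (k' k : ℕ), B.birthScale b ≤ k' → k' ≤ k → k + 1 ≤ B.K →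
      Real.exp 3 * (1 + 4 * θ b k / ϱ b k' k) ≤ α k)
    (hinv : ∀ b k' k, GaugeInvariant (rel b k' k) (Fn b k' k))
    (hmeas : ∀ (b f : B.Birth) (k'' k : ℕ) (U : Fld d R), AEStronglyMeasurable (fun z => Fn f k'' k (U + z)) (μ b k))
    (hdefw : ∀ b k' k, defect b k' k ≤ w)
    (hrate : ∀ (b : B.Birth) (k' k : ℕ), B.birthScale b ≤ k' → k' ≤ k → k ≤ B.K →
      defect b k' k ≤ cδ * ψ ^ (k - k'))
    (hlin : ∀ (b : B.Birth) (k' k : ℕ), B.birthScale b ≤ k' → k' ≤ k → k ≤ B.K →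
      RanBelow (budgetGate T s m S (4 * cδ / r) (fun i => ψ * α i)) k → ∀ ε > 0,
      ∃ U₀ ∈ 𝒦 b k' k, ∃ U₁ : Fld d R, RelGauge (rel b k' k) latMove latN U₀ U₁ (defect b k' k) ∧
        T.lin b k' k ≤ ‖Fn b k' k U₁ - Fn b k' k U₀‖ + ε) :
    T.TransportsFromVar (4 * cδ / r) (fun i => ψ * α i) (budgetGate T s m S (4 * cδ / r) (fun i => ψ * α i)) := by
  classical
  -- the dressed gate and its function-level strengthening
  set G : ℕ → Prop := budgetGate T s m S (4 * cδ / r) (fun i => ψ * α i) with hG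
  set G' : ℕ → Prop := fun i => G i ∧ ∀ b : B.Birth, B.birthScale b ≤ i → s b i + s1 b i ≤ 1 with hG'
  have hG'G : ∀ {k : ℕ}, RanBelow G' k → RanBelow G k := fun h => h.imp fun i _ hi => hi.1
  -- the radius floor for the current slice radii
  have hrs_floor : ∀ (f : B.Birth) (k'' k : ℕ), B.birthScale f ≤ k'' → k'' ≤ k → rstar ≤ rs f k'' k := by
    intro f k'' k hf hk''
    rcases Nat.lt_or_eq_of_le hk'' with hlt | heq
    · obtain ⟨k₀, rfl⟩ : ∃ k₀, k = k₀ + 1 := ⟨k - 1, by omega⟩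
      have hk₀ : k'' ≤ k₀ := Nat.lt_succ_iff.mp hlt
      rw [hrs_step f k'' k₀ hf hk₀]
      exact hϱfloor f k'' k₀ hf hk₀
    · subst heq
      rw [hrs_birth]
      exact hrstar_r
  -- (a) the size law of every live generation under the strengthened history
  have hAsz : ∀ k, k ≤ B.K → RanBelow G' k → ∀ (f : B.Birth) (k'' : ℕ), B.birthScale f ≤ k'' → k'' ≤ k →
      0 ≤ Asz f k'' k ∧ Asz f k'' k ≤ T.gen f k'' * stepProd α k'' k := by
    intro k
    induction k with
    | zero =>
      intro _ _ f k'' _ hk''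
      obtain rfl : k'' = 0 := Nat.le_zero.mp hk''
      rw [hAsz_birth, stepProd_self, mul_one]
      exact ⟨T.gen_nonneg f 0, le_rfl⟩
    | succ k ih =>
      intro hK hran f k'' hf hk''
      rcases Nat.lt_or_eq_of_le hk'' with hlt | heq
      · have hk''k : k'' ≤ k := Nat.lt_succ_iff.mp hlt
        have hkK : k < B.K := Nat.lt_of_succ_le hK
        obtain ⟨hA0, hAle⟩ := ih hkK.le (hran.mono k.le_succ) f k'' hf hk''k
        have hbud : s f k + s1 f k ≤ 1 := (hran k (Nat.lt_succ_self k)).2 f (hf.trans hk''k)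
        have hstep : Real.exp (3 * (s f k + s1 f k)) ≤ α k := by
          have h1 : Real.exp (3 * (s f k + s1 f k)) ≤ Real.exp 3 := Real.exp_le_exp.mpr (by linarith)
          have h2 : Real.exp 3 ≤ Real.exp 3 * (1 + 4 * θ f k / ϱ f k'' k) := by
            have h4 : 0 ≤ 4 * θ f k / ϱ f k'' k := div_nonneg (by linarith [(hθ f k).1]) (hϱ f k'' k).le
            exact le_mul_of_one_le_right (Real.exp_pos 3).le (by linarith)
          exact h1.trans (h2.trans (hdom f k'' k hf hk''k hK))
        rw [hAsz_step f k'' k hf hk''k, stepProd_succ α hk''k]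
        refine ⟨mul_nonneg (Real.exp_pos _).le hA0, ?_⟩
        calc Real.exp (3 * (s f k + s1 f k)) * Asz f k'' k ≤ α k * (T.gen f k'' * stepProd α k'' k) :=
              mul_le_mul hstep hAle hA0 (hα k)
          _ = T.gen f k'' * (stepProd α k'' k * α k) := by ring
      · subst heq
        rw [hAsz_birth, stepProd_self, mul_one]
        exact ⟨T.gen_nonneg f _, le_rfl⟩
  -- (b) the booked link: the function-level budget is below the dressed budget's envelope share
  have hs1le : ∀ k, k ≤ B.K → RanBelow G' k → ∀ b : B.Birth,
      s1 b k ≤ m * ∑ f ∈ S k b, T.envVar (4 * cδ / r) (fun i => ψ * α i) f k := by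
    intro k hK hran b
    rw [hs1 b k]
    exact budgetShare_le (A := fun p => Asz p.1 p.2 k) (rs := fun p => rs p.1 p.2 k) (δ := δf b k) hα hψ hcδ hr hrstar
      (norm_nonneg _) (hcm b k) (hSg k b)
      (fun p hp => hAsz k hK hran p.1 p.2 (hSg k b p hp).2.1 (hSg k b p hp).2.2)
      (fun p hp => hrs_floor p.1 p.2 k (hSg k b p hp).2.1 (hSg k b p hp).2.2) (hδf b k)
  -- (c) the dressed history IS the strengthened history
  have hconv : ∀ k, k ≤ B.K → RanBelow G k → RanBelow G' k := by
    intro k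
    induction k with
    | zero => exact fun _ _ => ranBelow_zero G'
    | succ k ih =>
      intro hK hran
      have hkK : k < B.K := Nat.lt_of_succ_le hK
      have hran' : RanBelow G' k := ih hkK.le (hran.mono k.le_succ)
      refine hran'.succ ⟨hran k (Nat.lt_succ_self k), fun b hb => ?_⟩
      have hg : s b k + m * ∑ f ∈ S k b, T.envVar (4 * cδ / r) (fun i => ψ * α i) f k ≤ 1 :=
        hran k (Nat.lt_succ_self k) b hb
      linarith [hs1le k hkK.le hran' b]
  -- (d) the centred perturbation slice under the history, at the dressed budget's size
  have hP : ∀ (b : B.Birth) (k' k : ℕ), B.birthScale b ≤ k' → k' ≤ k → k + 1 ≤ B.K → RanBelow G (k + 1) →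
      PertSlice (fun U z => 𝒬 b k U z - q b k U) (μ b k) latMove latN (𝒦 b k' (k + 1)) w (ϱ b k' k)
        (m * ∑ f ∈ S k b, T.envVar (4 * cδ / r) (fun i => ψ * α i) f k) := by
    intro b k' k hbk' hk'k hK hran
    have hran' : RanBelow G' (k + 1) := hconv (k + 1) hK hran
    have key := pertSlice_under_history (Gate := G') (T := T)
      (fun b k' h1 h2 h3 => hsl b k' h1 h2 (hG'G h3))
      (fun b k' k h1 h2 h3 h4 => hFn b k' k h1 h2 h3 (hG'G h4))
      (fun b k' k h1 h2 h3 h4 => hB b k' k h1 h2 h3 (hG'G h4))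
      (fun b k' k h1 h2 h3 h4 => hE b k' k h1 h2 h3 (hG'G h4))
      hQ (fun k b p hp => (hSg k b p hp).2) hs1 hAsz_birth hrs_birth hAsz_step hrs_step hrs_dec hmargin hDμ hN1 hN1x
      hN2cx hpairx hδfw hinv hmeas (fun k _ hg b hb => hg.2 b hb) b k' k hbk' hk'k hK hran'
    exact key.mono (hs1le k ((Nat.le_succ k).trans hK) (hran'.mono k.le_succ) b) le_rfl Subset.rfl
  -- (e) END-F by name
  exact transportLeaf_of_centredExponent hα hr hw hsl hFn h𝒢 hD hϱ hB hE hP hDμ hN1 hN2 hdiam hθ hdom hinv hdefw hrate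
    hlin

end FunctionLevel

end Summit.QuantumFields.BalabanUV.T4Continuum.NE1p.DressedTransportAssembled

end
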